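import Summits.BirchSwinnertonDyer.Rank1Residual.GaloisImage.ThreeLagrangianCount
import Mathlib.Algebra.Module.ZMod
import Mathlib.FieldTheory.Finiteness
import Mathlib.Algebra.Group.Subgroup.Finite
import HarnessLib

/-!
# The three-Lagrangian lemma, III: the local cost of a `p`-congruence at an additive place is
# `0` or `2` — the wrapper in GROUP CURRENCY with the three cohomological inputs as DISPLAYED BINDERS
# (cell `b2b-bsdres`, team n1011, seat p02 gen 9 — TOOL file; row T-K43-TOOL = r1 ROUTE-1 §43.1
# COROLLARY typed once; lead R5-86 (l); skeleton `cells/n1011/skel/T-K43.md`)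

HONEST FRAMING (cell `b2b-bsdres`, run/shared/lean/b2b/bsd-rank1-residual/, verbatim in every
file): the goal of the cell is to DELETE the COMBINATION-SHAPED residual classes of the
Birch–Swinnerton-Dyer formula for ALL analytic-rank `≤ 1` elliptic curves over `ℚ` — "full BSD
formula for every rank `≤ 1` curve in class `C`" assembled STRICTLY from published theorems — so
that the rank-`≤ 1` remainder becomes exactly the CONSTRUCTION-SHAPED classes, which are TYPED
(missing-input `Prop`s), NOT attempted. This is not "finishing BSD". Team n1011 (N10 / N11, the
additive block `X4 ∧ p = 3`): research route; no claim beyond the stated classes; labels UNCHANGED;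
nothing is booked. Theorems only (no definition, no named fact); a TOOL file: nothing here is a
class theorem and NO cohomology is constructed here: the cohomological inputs enter as binders of
the TOOL, each of which is a THEOREM OF THE TREE dischargeable by name (list below).

## The binders and their cohomological meaning (r1 ROUTE-1 §42.3 / §43.1; n1011-lit GEN 19 locators)

The theorems below are stated for an arbitrary additive group `H` with subgroups `W, L₁, L₂` and a
bi-additive `q : H →+ H →+ ZMod p` — the currency of the records lanes (`AddSubgroup`, `Nat.card`);
this is the TOOL SHAPE. In a K43 record they are MEANT to be instantiated as follows (`p = 3`,
`E/ℚ₃` with a `ℚ₃`-rational point `T` of order `3`, `M := E[3]`), and — n1011-lit GEN 19 (cell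
INBOX 2026-08-22T00:46Z/00:56Z), lead R5-87 (c) — EVERY input below is a THEOREM OF THE TREE, to be
discharged BY NAME by the record (no registry fact, no `[cite:]` input of ours, no `_holds` debt):

* `H` = `H¹(ℚ₃, M)` as an additive group (tree carrier:
  `galoisCohomology (GaloisRep.restrictField ℚ₃ (W.torsionGaloisModule 3)) 1`), `q := ι ∘` the
  local Weil cup product (`weilContPairing … |>.restrict (absGaloisRestrict K F)`, values in
  `H²(Γ_F, μ₃) ≅ ZMod 3` after `muEquivZMod`).
* (i) `hqnd` = `Literature.NumberTheory.EllipticCurves.eq_zero_of_forall_weilCupProduct_eq_zero[_right]`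
  (`LocalWeilPairingDuality.lean`: the local Weil cup product has trivial kernels — Tate local
  duality `localDuality_bijective` ∘ `weilDualLocalIso`); `hqs` = graded commutativity
  `ContPairing.cupProduct_comm` (`ContinuousCupProductCompat.lean`, NSW (1.4.4)) with `e₃`
  alternating (a short corollary, not yet stated in the tree); `hH` =
  `natCard_galoisCohomology_one_torsion_adicCompletion_eq_sq` fed by
  `localEulerPoincareCharacteristic_holds` (`#H = (3·3)² = 81`). (`p • H = 0` is DERIVED from
  `hqnd`, `nsmul_eq_zero_of_nondegenerate`.) Print meaning: Harari (2017) Thm. 10.9 / Milne *ADT*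
  I.2.3, I.2.8.
* (ii) `hL₁`, `hL₁c` = `L₁ := L_E = kummerLocalConditionAt 3 ℚ₃` is isotropic
  (`kummerClass_cupProduct_kummerClass_eq_zero_holds`,
  `forall_mem_kummerLocalConditionAt_weilCupProduct_eq_zero_iff` — Poonen–Rains Prop. 4.11,
  DISCHARGED in the tree) of order `natCard_kummerLocalConditionAt_adicCompletion = 9`; the same for
  `L₂ := θ_* L_{E'}` transported along the `3`-congruence `θ : E'[3] ⥲ E[3]`.
* (iii) `hW`, `hWc` = `W := ι_* H¹(ℚ₃, ⟨T⟩)`: isotropic (`e₃|⟨T⟩×⟨T⟩ = 1` + `cupProduct_map`) of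
  order `9` (`localEulerPoincareCharacteristic_trivial_prime_adicCompletion`: `#H¹(ℚ₃, 𝔽₃) = 9`).
* `hL₁W`, `hL₂W` = the `(A, A') = (0, 0)` condition of §42–43 (`L_E ∩ W = 0 = θ_* L_{E'} ∩ W`,
  read by the Tate–Lichtenbaum instrument `t_T`; a per-pair CERTIFICATE input of the record).

## What this file proves

* §1 transport: `nsmul_eq_zero_of_nondegenerate` (`p • H = 0` from (i)),
  `finrank_eq_of_natCard_eq_pow` (`#M = p^k ⟹ dim_{𝔽_p} M = k`).
* §2 **`addSubgroup_eq_or_inf_eq_bot`** — for an odd prime `p`, under (i)–(iii) and `(0,0)`: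
  `L₁ = L₂ ∨ L₁ ⊓ L₂ = ⊥`; **`natCard_inf_eq_sq_or_eq_one`** — `#(L₁ ⊓ L₂) = p² ∨ #(L₁ ⊓ L₂) = 1`,
  i.e. the COST `d_p := 2 − dim (L₁ ⊓ L₂) ∈ {0, 2}` (r1 §43.1 COROLLARY, "UNCONDITIONALLY and
  LOCALLY"); `natCard_inf_ne` — `#(L₁ ⊓ L₂) ≠ p` (`d_p = 1` is impossible);
  `natCard_transverseLagrangians_addSubgroup_eq` — given one base `L₀`, the subgroups `L` with
  `#L = p²`, isotropic, `L ⊓ W = ⊥` number EXACTLY `p` (the `ℤ/p`-torsor of §43.1; O42 asks whether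
  `L_E` and `θ_* L_{E'}` are the same point of it).
* §3 the `p = 3` literal twins (`#H = 81`, `#W = #L_i = 9`): `addSubgroup_eq_or_inf_eq_bot_three`,
  `natCard_inf_eq_nine_or_eq_one`, `natCard_inf_ne_three`, `natCard_transverseLagrangians_eq_three'`
  ("one of exactly three").

Nothing here decides `d₃ = 0` versus `d₃ = 2` for a given pair: that is the SPLIT / NONSPLIT
decider of §43.2–43.3 (records ST-43a K43:SGN, ST-43b K43:CUBE), which consumes this file by name.
-/

open Module Submodule

namespace Summit.BirchSwinnertonDyer.Rank1Residual.GaloisImage.ThreeLagrangian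

/-! ## §1 Transport: `𝔽_p`-structure and dimensions from cardinalities -/

section Transport

variable {H : Type*} [AddCommGroup H] {p : ℕ} [hp : Fact p.Prime]

/-- A group carrying a bi-additive `ZMod p`-valued pairing that is non-degenerate on the left is
killed by `p`: `q (p • x) y = p • q x y = 0`. [folklore] -/
theorem nsmul_eq_zero_of_nondegenerate (q : H →+ H →+ ZMod p)
    (hqnd : ∀ x, (∀ y, q x y = 0) → x = 0) (x : H) : p • x = 0 := by
  refine hqnd _ fun y ↦ ?_
  rw [map_nsmul, AddMonoidHom.nsmul_apply, nsmul_eq_mul, ZMod.natCast_self, zero_mul]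

/-- A `ZMod p`-module with `p ^ k` elements has dimension `k`. [folklore] -/
theorem finrank_eq_of_natCard_eq_pow {M : Type*} [AddCommGroup M] [Module (ZMod p) M] {k : ℕ}
    (h : Nat.card M = p ^ k) : finrank (ZMod p) M = k := by
  haveI : Finite M := Nat.finite_of_card_ne_zero (by rw [h]; exact pow_ne_zero _ hp.out.ne_zero)
  have hc := Module.natCard_eq_pow_finrank (K := ZMod p) (V := M)
  rw [h, Nat.card_zmod] at hc
  exact (Nat.pow_right_injective hp.out.two_le hc).symm

/-- A finite `ZMod p`-module of dimension `k` has `p ^ k` elements. [folklore] -/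
theorem natCard_eq_pow_of_finrank_eq {M : Type*} [AddCommGroup M] [Module (ZMod p) M] [Finite M]
    {k : ℕ} (h : finrank (ZMod p) M = k) : Nat.card M = p ^ k := by
  rw [Module.natCard_eq_pow_finrank (K := ZMod p) (V := M), Nat.card_zmod, h]

end Transport

/-! ## §2 The cost dichotomy in group currency (odd prime `p`) -/

section Cost

variable {H : Type*} [AddCommGroup H] {p : ℕ} [hp : Fact p.Prime]

/-- **The three-Lagrangian dichotomy, group currency (r1 ROUTE-1 §43.1 COROLLARY).** Let `p` be an
odd prime and `H` an additive group with a bi-additive pairing `q : H × H → ZMod p` which is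
SYMMETRIC and NON-DEGENERATE, `#H = p⁴` [binder (i): Tate local duality + Euler characteristic for
`H = H¹(ℚ_ℓ, E[p])`, `ℓ` the additive place]; let `W, L₁, L₂ ≤ H` have `p²` elements each and be isotropic
[binders (iii), (ii): `W = ι_* H¹(⟨T⟩)`, `L₁ = im κ`, `L₂ = θ_* im κ'`], with `L₁ ⊓ W = ⊥ = L₂ ⊓ W`
[the `(0,0)` condition]. Then `L₁ = L₂` or `L₁ ⊓ L₂ = ⊥`. (Transport to `𝔽_p`-linear algebra by
`AddCommGroup.zmodModule` / `AddSubgroup.toZModSubmodule`, then PART A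
`LagrangianDichotomy.eq_or_inf_eq_bot_of_finrank_eq_four`, p12 p311626, BY NAME.)
[folklore] -/
theorem addSubgroup_eq_or_inf_eq_bot (hp2 : p ≠ 2) (q : H →+ H →+ ZMod p)
    (hqs : ∀ x y, q x y = q y x) (hqnd : ∀ x, (∀ y, q x y = 0) → x = 0) (hH : Nat.card H = p ^ 4)
    {W L₁ L₂ : AddSubgroup H} (hWc : Nat.card W = p ^ 2) (hL₁c : Nat.card L₁ = p ^ 2)
    (hL₂c : Nat.card L₂ = p ^ 2) (hW : ∀ x ∈ W, ∀ y ∈ W, q x y = 0)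
    (hL₁ : ∀ x ∈ L₁, ∀ y ∈ L₁, q x y = 0) (hL₂ : ∀ x ∈ L₂, ∀ y ∈ L₂, q x y = 0)
    (hL₁W : L₁ ⊓ W = ⊥) (hL₂W : L₂ ⊓ W = ⊥) :
    L₁ = L₂ ∨ L₁ ⊓ L₂ = ⊥ := by
  -- an `𝔽_p`-structure (opaque local instance: only its existence is used)
  obtain ⟨_inst⟩ : Nonempty (Module (ZMod p) H) :=
    ⟨AddCommGroup.zmodModule (nsmul_eq_zero_of_nondegenerate q hqnd)⟩
  -- the pairing as a bilinear form
  obtain ⟨B, hB⟩ : ∃ B : LinearMap.BilinForm (ZMod p) H, ∀ x y, B x y = q x y :=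
    ⟨LinearMap.mk₂ (ZMod p) (fun x y ↦ q x y) (fun x x' y ↦ by rw [map_add, AddMonoidHom.add_apply])
      (fun c x y ↦ by rw [hqs (c • x) y, ZMod.map_smul (q y) c x, hqs y x])
      (fun x y y' ↦ map_add (q x) y y') (fun c x y ↦ ZMod.map_smul (q x) c y), fun _ _ ↦ rfl⟩
  -- the subgroups as `𝔽_p`-subspaces
  let e : AddSubgroup H ≃o Submodule (ZMod p) H := AddSubgroup.toZModSubmodule p
  have hinf : ∀ S T : AddSubgroup H, S ⊓ T = ⊥ → e S ⊓ e T = ⊥ := fun S T h ↦ by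
    rw [← e.map_inf, h, e.map_bot]
  -- PART A's hypotheses from the displayed binders
  haveI : NeZero (2 : ZMod p) := ⟨fun h ↦ hp2 <| (Nat.prime_dvd_prime_iff_eq hp.out Nat.prime_two).mp <|
    (ZMod.natCast_eq_zero_iff 2 p).mp (by exact_mod_cast h)⟩  -- `(2 : ZMod p) ≠ 0`; cf.
    -- `Literature.NumberTheory.EllipticCurves.BinaryQuartic.two_ne_zero_zmod` (not imported)
  haveI : Finite H := Nat.finite_of_card_ne_zero (by rw [hH]; exact pow_ne_zero _ hp.out.ne_zero)
  have hBs : B.IsSymm := ⟨fun x y ↦ by rw [hB, hB, hqs]⟩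
  have hBnd : B.Nondegenerate :=
    ⟨fun x hx ↦ hqnd x fun y ↦ by rw [← hB]; exact hx y,
      fun y hy ↦ hqnd y fun x ↦ by rw [hqs, ← hB]; exact hy x⟩
  have h := LagrangianDichotomy.eq_or_inf_eq_bot_of_finrank_eq_four B hBnd hBs
    (finrank_eq_of_natCard_eq_pow hH) (W := e W) (L := e L₁) (L' := e L₂)
    (fun x hx y hy ↦ (hB x y).trans (hW x hx y hy)) (fun x hx y hy ↦ (hB x y).trans (hL₁ x hx y hy))
    (fun x hx y hy ↦ (hB x y).trans (hL₂ x hx y hy)) (finrank_eq_of_natCard_eq_pow hWc)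
    (finrank_eq_of_natCard_eq_pow hL₁c) (finrank_eq_of_natCard_eq_pow hL₂c)
    (hinf _ _ hL₁W) (hinf _ _ hL₂W)
  rcases h with h | h
  · exact Or.inl (e.injective h)
  · refine Or.inr (e.injective ?_)
    rw [e.map_inf, e.map_bot]
    exact h

/-- **The cost is `0` or `2`: `#(L₁ ⊓ L₂) ∈ {p², 1}`** under the hypotheses of
`addSubgroup_eq_or_inf_eq_bot` (`d_p := 2 − dim_{𝔽_p}(L₁ ⊓ L₂) ∈ {0, 2}`, r1 ROUTE-1 §43.1
COROLLARY: "UNCONDITIONALLY and LOCALLY"). [folklore] -/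
theorem natCard_inf_eq_sq_or_eq_one (hp2 : p ≠ 2) (q : H →+ H →+ ZMod p)
    (hqs : ∀ x y, q x y = q y x) (hqnd : ∀ x, (∀ y, q x y = 0) → x = 0) (hH : Nat.card H = p ^ 4)
    {W L₁ L₂ : AddSubgroup H} (hWc : Nat.card W = p ^ 2) (hL₁c : Nat.card L₁ = p ^ 2)
    (hL₂c : Nat.card L₂ = p ^ 2) (hW : ∀ x ∈ W, ∀ y ∈ W, q x y = 0)
    (hL₁ : ∀ x ∈ L₁, ∀ y ∈ L₁, q x y = 0) (hL₂ : ∀ x ∈ L₂, ∀ y ∈ L₂, q x y = 0)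
    (hL₁W : L₁ ⊓ W = ⊥) (hL₂W : L₂ ⊓ W = ⊥) :
    Nat.card ↥(L₁ ⊓ L₂) = p ^ 2 ∨ Nat.card ↥(L₁ ⊓ L₂) = 1 := by
  rcases addSubgroup_eq_or_inf_eq_bot hp2 q hqs hqnd hH hWc hL₁c hL₂c hW hL₁ hL₂ hL₁W hL₂W
    with h | h
  · left; rw [← h, inf_idem, hL₁c]
  · right; rw [h, AddSubgroup.card_bot]

/-- **`d_p = 1` is impossible: `#(L₁ ⊓ L₂) ≠ p`** under the hypotheses of
`addSubgroup_eq_or_inf_eq_bot`. [folklore] -/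
theorem natCard_inf_ne (hp2 : p ≠ 2) (q : H →+ H →+ ZMod p)
    (hqs : ∀ x y, q x y = q y x) (hqnd : ∀ x, (∀ y, q x y = 0) → x = 0) (hH : Nat.card H = p ^ 4)
    {W L₁ L₂ : AddSubgroup H} (hWc : Nat.card W = p ^ 2) (hL₁c : Nat.card L₁ = p ^ 2)
    (hL₂c : Nat.card L₂ = p ^ 2) (hW : ∀ x ∈ W, ∀ y ∈ W, q x y = 0)
    (hL₁ : ∀ x ∈ L₁, ∀ y ∈ L₁, q x y = 0) (hL₂ : ∀ x ∈ L₂, ∀ y ∈ L₂, q x y = 0)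
    (hL₁W : L₁ ⊓ W = ⊥) (hL₂W : L₂ ⊓ W = ⊥) :
    Nat.card ↥(L₁ ⊓ L₂) ≠ p := by
  have hp1 : 1 < p := hp.out.one_lt
  rcases natCard_inf_eq_sq_or_eq_one hp2 q hqs hqnd hH hWc hL₁c hL₂c hW hL₁ hL₂ hL₁W hL₂W
    with h | h <;> rw [h]
  · intro h'
    have : p * p = p * 1 := by rw [mul_one, ← sq]; exact h'
    exact absurd (Nat.eq_of_mul_eq_mul_left hp.out.pos this) hp1.ne'
  · exact hp1.ne

/-- **The transverse Lagrangians number exactly `p` (the `ℤ/p`-torsor of r1 §43.1), group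
currency.** Under binders (i), (iii) and given ONE isotropic `L₀ ≤ H` with `#L₀ = p²` and
`L₀ ⊓ W = ⊥` [e.g. `L₀ = L_E` on a curve with `A = 0`], the subgroups `L ≤ H` with `#L = p²`,
`L` isotropic and `L ⊓ W = ⊥` are exactly `p` in number (file II `natCard_transverseLagrangians_eq`
transported along `AddSubgroup.toZModSubmodule`). [folklore] -/
theorem natCard_transverseLagrangians_addSubgroup_eq (hp2 : p ≠ 2) (q : H →+ H →+ ZMod p)
    (hqs : ∀ x y, q x y = q y x) (hqnd : ∀ x, (∀ y, q x y = 0) → x = 0) (hH : Nat.card H = p ^ 4)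
    {W L₀ : AddSubgroup H} (hWc : Nat.card W = p ^ 2) (hL₀c : Nat.card L₀ = p ^ 2)
    (hW : ∀ x ∈ W, ∀ y ∈ W, q x y = 0) (hL₀ : ∀ x ∈ L₀, ∀ y ∈ L₀, q x y = 0) (hL₀W : L₀ ⊓ W = ⊥) :
    Nat.card {L : AddSubgroup H //
      Nat.card L = p ^ 2 ∧ (∀ x ∈ L, ∀ y ∈ L, q x y = 0) ∧ L ⊓ W = ⊥} = p := by
  -- an `𝔽_p`-structure (opaque local instance: only its existence is used)
  obtain ⟨_inst⟩ : Nonempty (Module (ZMod p) H) :=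
    ⟨AddCommGroup.zmodModule (nsmul_eq_zero_of_nondegenerate q hqnd)⟩
  haveI : Finite H := Nat.finite_of_card_ne_zero (by rw [hH]; exact pow_ne_zero _ hp.out.ne_zero)
  obtain ⟨B, hB⟩ : ∃ B : LinearMap.BilinForm (ZMod p) H, ∀ x y, B x y = q x y :=
    ⟨LinearMap.mk₂ (ZMod p) (fun x y ↦ q x y) (fun x x' y ↦ by rw [map_add, AddMonoidHom.add_apply])
      (fun c x y ↦ by rw [hqs (c • x) y, ZMod.map_smul (q y) c x, hqs y x])
      (fun x y y' ↦ map_add (q x) y y') (fun c x y ↦ ZMod.map_smul (q x) c y), fun _ _ ↦ rfl⟩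
  let e : AddSubgroup H ≃o Submodule (ZMod p) H := AddSubgroup.toZModSubmodule p
  have hinf : ∀ S T : AddSubgroup H, S ⊓ T = ⊥ ↔ e S ⊓ e T = ⊥ := fun S T ↦ by
    rw [← e.map_inf, ← e.map_bot, e.injective.eq_iff]
  haveI : NeZero (2 : ZMod p) := ⟨fun h ↦ hp2 <| (Nat.prime_dvd_prime_iff_eq hp.out Nat.prime_two).mp <|
    (ZMod.natCast_eq_zero_iff 2 p).mp (by exact_mod_cast h)⟩  -- `(2 : ZMod p) ≠ 0`; cf.
    -- `Literature.NumberTheory.EllipticCurves.BinaryQuartic.two_ne_zero_zmod` (not imported)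
  have hBs : B.IsSymm := ⟨fun x y ↦ by rw [hB, hB, hqs]⟩
  have hBnd : B.Nondegenerate :=
    ⟨fun x hx ↦ hqnd x fun y ↦ by rw [← hB]; exact hx y,
      fun y hy ↦ hqnd y fun x ↦ by rw [hqs, ← hB]; exact hy x⟩
  have hcount := natCard_transverseLagrangians_eq B (W := e W) (Λ₀ := e L₀) hBnd hBs
    (finrank_eq_of_natCard_eq_pow hH) (finrank_eq_of_natCard_eq_pow hWc)
    (finrank_eq_of_natCard_eq_pow hL₀c) (fun x hx y hy ↦ (hB x y).trans (hW x hx y hy))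
    (fun x hx y hy ↦ (hB x y).trans (hL₀ x hx y hy)) ((hinf _ _).mp hL₀W)
  rw [Nat.card_zmod] at hcount
  refine Eq.trans (Nat.card_congr (Equiv.subtypeEquiv e.toEquiv fun L ↦ ?_)) hcount
  change _ ↔ finrank (ZMod p) ↥(e L) = 2 ∧ (∀ x ∈ e L, ∀ y ∈ e L, B x y = 0) ∧ e L ⊓ e W = ⊥
  refine and_congr ⟨fun h ↦ finrank_eq_of_natCard_eq_pow (M := ↥(e L)) h,
    fun h ↦ natCard_eq_pow_of_finrank_eq (M := ↥(e L)) h⟩ (and_congr ?_ (hinf _ _))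
  exact ⟨fun h x hx y hy ↦ (hB x y).trans (h x hx y hy),
    fun h x hx y hy ↦ (hB x y).symm.trans (h x hx y hy)⟩

end Cost

/-! ## §3 The `p = 3` literal twins (`#H¹(ℚ₃, E[3]) = 81`, `#W = #L_E = #θ_* L_{E'} = 9`) -/

section Three

variable {H : Type*} [AddCommGroup H]

/-- **`d₃ ∈ {0, 2}`, subgroup form, `p = 3`.** `H` an additive group with a symmetric
non-degenerate bi-additive pairing `q : H × H → ZMod 3` and `#H = 81` [binder (i), Tate local
duality for `E[3]` over `ℚ₃`], `W, L₁, L₂ ≤ H` isotropic of order `9` [binders (iii), (ii)] with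
`L₁ ⊓ W = ⊥ = L₂ ⊓ W` [`(A, A') = (0, 0)`]: then `L₁ = L₂ ∨ L₁ ⊓ L₂ = ⊥`. [folklore] -/
theorem addSubgroup_eq_or_inf_eq_bot_three (q : H →+ H →+ ZMod 3)
    (hqs : ∀ x y, q x y = q y x) (hqnd : ∀ x, (∀ y, q x y = 0) → x = 0) (hH : Nat.card H = 81)
    {W L₁ L₂ : AddSubgroup H} (hWc : Nat.card W = 9) (hL₁c : Nat.card L₁ = 9)
    (hL₂c : Nat.card L₂ = 9) (hW : ∀ x ∈ W, ∀ y ∈ W, q x y = 0)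
    (hL₁ : ∀ x ∈ L₁, ∀ y ∈ L₁, q x y = 0) (hL₂ : ∀ x ∈ L₂, ∀ y ∈ L₂, q x y = 0)
    (hL₁W : L₁ ⊓ W = ⊥) (hL₂W : L₂ ⊓ W = ⊥) :
    L₁ = L₂ ∨ L₁ ⊓ L₂ = ⊥ :=
  addSubgroup_eq_or_inf_eq_bot (p := 3) (by decide) q hqs hqnd (hH.trans (by norm_num))
    (hWc.trans (by norm_num)) (hL₁c.trans (by norm_num)) (hL₂c.trans (by norm_num))
    hW hL₁ hL₂ hL₁W hL₂W

/-- **`#(L₁ ⊓ L₂) = 9 ∨ #(L₁ ⊓ L₂) = 1`** (`d₃ = 0` or `d₃ = 2`), `p = 3` literal form of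
`natCard_inf_eq_sq_or_eq_one`. [folklore] -/
theorem natCard_inf_eq_nine_or_eq_one (q : H →+ H →+ ZMod 3)
    (hqs : ∀ x y, q x y = q y x) (hqnd : ∀ x, (∀ y, q x y = 0) → x = 0) (hH : Nat.card H = 81)
    {W L₁ L₂ : AddSubgroup H} (hWc : Nat.card W = 9) (hL₁c : Nat.card L₁ = 9)
    (hL₂c : Nat.card L₂ = 9) (hW : ∀ x ∈ W, ∀ y ∈ W, q x y = 0)
    (hL₁ : ∀ x ∈ L₁, ∀ y ∈ L₁, q x y = 0) (hL₂ : ∀ x ∈ L₂, ∀ y ∈ L₂, q x y = 0)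
    (hL₁W : L₁ ⊓ W = ⊥) (hL₂W : L₂ ⊓ W = ⊥) :
    Nat.card ↥(L₁ ⊓ L₂) = 9 ∨ Nat.card ↥(L₁ ⊓ L₂) = 1 := by
  have h := natCard_inf_eq_sq_or_eq_one (p := 3) (by decide) q hqs hqnd (hH.trans (by norm_num))
    (hWc.trans (by norm_num)) (hL₁c.trans (by norm_num)) (hL₂c.trans (by norm_num))
    hW hL₁ hL₂ hL₁W hL₂W
  norm_num at h
  exact h

/-- **`d₃ = 1` is impossible: `#(L₁ ⊓ L₂) ≠ 3`**, `p = 3` literal form of `natCard_inf_ne`.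
[folklore] -/
theorem natCard_inf_ne_three (q : H →+ H →+ ZMod 3)
    (hqs : ∀ x y, q x y = q y x) (hqnd : ∀ x, (∀ y, q x y = 0) → x = 0) (hH : Nat.card H = 81)
    {W L₁ L₂ : AddSubgroup H} (hWc : Nat.card W = 9) (hL₁c : Nat.card L₁ = 9)
    (hL₂c : Nat.card L₂ = 9) (hW : ∀ x ∈ W, ∀ y ∈ W, q x y = 0)
    (hL₁ : ∀ x ∈ L₁, ∀ y ∈ L₁, q x y = 0) (hL₂ : ∀ x ∈ L₂, ∀ y ∈ L₂, q x y = 0)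
    (hL₁W : L₁ ⊓ W = ⊥) (hL₂W : L₂ ⊓ W = ⊥) :
    Nat.card ↥(L₁ ⊓ L₂) ≠ 3 :=
  natCard_inf_ne (p := 3) (by decide) q hqs hqnd (hH.trans (by norm_num))
    (hWc.trans (by norm_num)) (hL₁c.trans (by norm_num)) (hL₂c.trans (by norm_num))
    hW hL₁ hL₂ hL₁W hL₂W

/-- **"A Lagrangian transverse to `W` is one of EXACTLY THREE"**, subgroup form (r1 ROUTE-1 §43.1
(b): the torsor `{L_E-candidates} ≅ ℤ/3` whose coordinate O42 compares): under binder (i) with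
`#H = 81`, binder (iii) with `#W = 9`, and one isotropic `L₀` of order `9` with `L₀ ⊓ W = ⊥`, the
subgroups `L ≤ H` of order `9`, isotropic, with `L ⊓ W = ⊥` are exactly `3`. [folklore] -/
theorem natCard_transverseLagrangians_eq_three' (q : H →+ H →+ ZMod 3)
    (hqs : ∀ x y, q x y = q y x) (hqnd : ∀ x, (∀ y, q x y = 0) → x = 0) (hH : Nat.card H = 81)
    {W L₀ : AddSubgroup H} (hWc : Nat.card W = 9) (hL₀c : Nat.card L₀ = 9)
    (hW : ∀ x ∈ W, ∀ y ∈ W, q x y = 0) (hL₀ : ∀ x ∈ L₀, ∀ y ∈ L₀, q x y = 0) (hL₀W : L₀ ⊓ W = ⊥) :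
    Nat.card {L : AddSubgroup H //
      Nat.card L = 9 ∧ (∀ x ∈ L, ∀ y ∈ L, q x y = 0) ∧ L ⊓ W = ⊥} = 3 := by
  have h := natCard_transverseLagrangians_addSubgroup_eq (p := 3) (by decide) q hqs hqnd
    (hH.trans (by norm_num)) (hWc.trans (by norm_num)) (hL₀c.trans (by norm_num)) hW hL₀ hL₀W
  norm_num at h
  exact h

end Three

end Summit.BirchSwinnertonDyer.Rank1Residual.GaloisImage.ThreeLagrangian
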